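import Summits.AtomisticToContinuum.Crystallization.Theorems.ChargedEnergyGapChartDialW
import Literature.Geometry.DiscreteGeometry.ShellCensusTwelve

/-!
# `ChargedEnergyGap` · the CHART DIAL, part ZH: [C] TRANSLATED TO WINDOWED SPHERICAL CODES
(decomp-a2c lens-3 g40 node «SphericalDozen»; beneath hypothesis 3 of the node of record on
`PricedLinkCensus.ChargedEnergyGap`, slot `hCEG` of the RDEF cones)

After parts ZC ([G] `DozenBondGraphs fccTuple hcpTuple`) and ZF ([A] `NoAntiprismDozen`) the only open mathematics on
hypothesis 3 `ChargeFreeShaped θ` of the P line is the pair [C] `GraphedDozenClose θ fccTuple`, `GraphedDozenClose θ hcpTuple`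
(part Q): every SCALE-FREE DOZEN `IsScaleFreeDozen t b` whose bond graph is that of the pattern is `θ`-`TupleClose` to it.
A scale-free dozen has twelve radial unknowns `‖t k‖ ∈ [1, 101/100]` and five families of metric clauses (R1)(R2)(R4)(R5).
This file removes the radial unknowns ONCE AND FOR ALL: it is a certified translation

  `SphericalGraphedClose θ₁ p → GraphedDozenClose θ p`     whenever `101/100 · θ₁² + 1/10000 ≤ θ²`, `0 ≤ θ`, `‖p k‖ = 1`,

where `SphericalGraphedClose θ₁ p` ([C^sph]) quantifies over WINDOWED SPHERICAL CODES `IsWindowedCode u b` only: twelve UNIT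
vectors, every two distinct directions at cosine `≤ 5201/10201` (chord `≥ 100/101`), every bonded pair at cosine `≥ 9799/20000`
(chord `≤ 101/100`), `b` symmetric, irreflexive, `4`-regular.  The two windows are EXACTLY part T's `cos_upper` / `cos_lower`
(part W's dictionary with its sharp constants), so the translation of the HYPOTHESES is lossless; the only loss is radial, in the
CONCLUSION: a point of norm `s ∈ [1, 101/100]` whose direction is `θ₁`-close to a unit vector `q` is at distance
`≤ √((s-1)² + s θ₁²) ≤ √(1/10000 + 101/100 · θ₁²)` from `q` (`dist_le_of_normalize_close`).  At the dial value `θ = 3/20` every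
`θ₁ ≤ 0·1489` is admissible; the literal instances below use `θ₁ = 37/250 = 0·148`
(`101/100 · (37/250)² + 1/10000 = 0·0222234 ≤ 0·0225`).

Calibration (lens-3 g40 memo, float + closed form, NOT used here): both spherical contact frameworks have exactly one
first-order flex and reach `Θ(√(c²-1))` inside the window — cuboctahedral (fcc) jitterbug `0·100376`, anticuboctahedral (hcp)
bicupola counter-twist `0·133856` at `c = 101/100` — so `[C^sph](37/250, hcpTuple)` carries margin `≈ 0·014` and is the binding leaf.

Contents: `IsWindowedCode`, `SphericalGraphedClose` (defs); `IsScaleFreeDozen.inner_normalize_le_sharp` /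
`.le_inner_normalize_sharp` / `.isWindowedCode_normalize` (the dictionary with sharp constants); `dist_le_of_normalize_close`,
`tupleClose_of_normalize` (radial loss); `graphedDozenClose_of_spherical` (+ the two literal instances at `3/20 ← 37/250`).
No `sorry`, no new axiom, no instance / notation / option.
-/

noncomputable section

open scoped RealInnerProductSpace
open Literature.MathematicalPhysics.StatisticalMechanics
open Literature.Geometry.DiscreteGeometry
open Literature.Geometry.DiscreteGeometry.ShellCensus
open Summit.AtomisticToContinuum.Crystallization.Theses.PricedLinkCensus
open Summit.AtomisticToContinuum.Crystallization.Theorems.ChargedEnergyGapNegative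

namespace Summit.AtomisticToContinuum.Crystallization.Theorems.ChargedEnergyGapChartDial

/-! ## §1 Windowed spherical codes and the spherical form of [C] -/

/-- A **windowed spherical code** with contact graph `b`: twelve unit vectors; every two distinct directions at cosine
`≤ 5201/10201` (chord `≥ 100/101`); every bonded pair at cosine `≥ 9799/20000` (chord `≤ 101/100`); `b` symmetric, irreflexive
and `4`-regular.  This is exactly the image of part W's dictionary of a scale-free dozen. -/
def IsWindowedCode (u : Fin 12 → E3) (b : Fin 12 → Fin 12 → Prop) : Prop :=
  (∀ k, ‖u k‖ = 1) ∧
  (∀ k l, k ≠ l → ⟪u k, u l⟫ ≤ 5201 / 10201) ∧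
  (∀ k l, b k l → (9799 : ℝ) / 20000 ≤ ⟪u k, u l⟫) ∧
  (∀ k l, b k l → b l k) ∧ (∀ k, ¬ b k k) ∧ (∀ k, {l | b k l}.ncard = 4)

/-- **[C^sph]** `SphericalGraphedClose θ₁ p`: every windowed spherical code whose contact graph is (up to the relabelling
`σ`) the unit-distance graph of the pattern tuple `p` is `θ₁`-`TupleClose` to `p`. -/
def SphericalGraphedClose (θ₁ : ℝ) (p : Fin 12 → E3) : Prop :=
  ∀ (u : Fin 12 → E3) (b : Fin 12 → Fin 12 → Prop), IsWindowedCode u b →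
    ∀ σ : Equiv.Perm (Fin 12), TupleIso b σ p → TupleClose θ₁ u p

/-! ## §2 The dictionary with sharp constants -/

namespace IsScaleFreeDozen

variable {t : Fin 12 → E3} {b : Fin 12 → Fin 12 → Prop}

/-- All pairs, sharp form of part W's `inner_normalize_le`: cosine `≤ 5201/10201` (part T's `cos_upper`). -/
theorem inner_normalize_le_sharp (hD : IsScaleFreeDozen t b) {k l : Fin 12} (hkl : k ≠ l) :
    ⟪‖t k‖⁻¹ • t k, ‖t l‖⁻¹ • t l⟫ ≤ 5201 / 10201 := by
  have hk := hD.norm_pos k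
  have hl := hD.norm_pos l
  rw [inner_normalize_eq hk hl, div_le_iff₀ (mul_pos hk hl)]
  have g : ⟪t k, t l⟫ = (‖t k‖ ^ 2 + ‖t l‖ ^ 2 - dist (t k) (t l) ^ 2) / 2 := by
    rw [dist_eq_norm, norm_sub_sq_real]; ring
  have h := cos_upper (hD.one_le_norm k) (hD.norm_le k) (hD.one_le_norm l) (hD.norm_le l) (hD.norm_le_dist hkl)
    (hD.norm_le_dist' hkl)
  rw [← g] at h
  exact h

/-- Bonds, sharp form of part W's `le_inner_normalize`: cosine `≥ 9799/20000` (part T's `cos_lower`). -/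
theorem le_inner_normalize_sharp (hD : IsScaleFreeDozen t b) {k l : Fin 12} (hb : b k l) :
    (9799 : ℝ) / 20000 ≤ ⟪‖t k‖⁻¹ • t k, ‖t l‖⁻¹ • t l⟫ := by
  have hk := hD.norm_pos k
  have hl := hD.norm_pos l
  rw [inner_normalize_eq hk hl, le_div_iff₀ (mul_pos hk hl)]
  have g : ⟪t k, t l⟫ = (‖t k‖ ^ 2 + ‖t l‖ ^ 2 - dist (t k) (t l) ^ 2) / 2 := by
    rw [dist_eq_norm, norm_sub_sq_real]; ring
  have h := cos_lower hk.le hl.le dist_nonneg (hD.dist_le_norm hb) (hD.dist_le_norm' hb)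
  rw [← g] at h
  exact h

/-- **The dictionary**: the radial projection of a scale-free dozen is a windowed spherical code with the same contact graph. -/
theorem isWindowedCode_normalize (hD : IsScaleFreeDozen t b) : IsWindowedCode (fun k => ‖t k‖⁻¹ • t k) b :=
  ⟨hD.norm_normalize, fun _ _ hkl => hD.inner_normalize_le_sharp hkl, fun _ _ hb => hD.le_inner_normalize_sharp hb,
    fun _ _ h => hD.symm h, hD.irrefl, hD.ncard_bond⟩

end IsScaleFreeDozen

/-! ## §3 The radial loss -/

/-- **Radial loss, one point.**  If `1 ≤ ‖x‖ ≤ 101/100`, `‖q‖ = 1` and the direction of `x` is `θ₁`-close to `q`, then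
`dist x q ^ 2 ≤ 1/10000 + 101/100 · θ₁²`: indeed `dist x q ^ 2 = (‖x‖ - 1)² + ‖x‖ · dist (x/‖x‖) q ^ 2`. -/
theorem dist_sq_le_of_normalize_close {x q : E3} {θ₁ : ℝ} (h1 : 1 ≤ ‖x‖) (h2 : ‖x‖ ≤ 101 / 100) (hq : ‖q‖ = 1)
    (h : dist (‖x‖⁻¹ • x) q ≤ θ₁) : dist x q ^ 2 ≤ 1 / 10000 + 101 / 100 * θ₁ ^ 2 := by
  have hx : 0 < ‖x‖ := by linarith
  have hu : ‖‖x‖⁻¹ • x‖ = 1 := by rw [norm_smul, norm_inv, norm_norm, inv_mul_cancel₀ hx.ne']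
  have he : dist (‖x‖⁻¹ • x) q ^ 2 ≤ θ₁ ^ 2 := pow_le_pow_left₀ dist_nonneg h 2
  have e1 : dist (‖x‖⁻¹ • x) q ^ 2 = 2 - 2 * (‖x‖⁻¹ * ⟪x, q⟫) := by
    rw [dist_eq_norm, norm_sub_sq_real, hu, hq, real_inner_smul_left]; ring
  have e2 : dist x q ^ 2 = ‖x‖ ^ 2 - 2 * ⟪x, q⟫ + 1 := by
    rw [dist_eq_norm, norm_sub_sq_real, hq]; ring
  have hX : ‖x‖ * (‖x‖⁻¹ * ⟪x, q⟫) = ⟪x, q⟫ := by field_simp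
  -- `Y := ‖x‖⁻¹ ⟪x, q⟫ ≥ 1 - θ₁²/2`, `⟪x, q⟫ = ‖x‖ Y`
  have hY : 1 - θ₁ ^ 2 / 2 ≤ ‖x‖⁻¹ * ⟪x, q⟫ := by linarith
  have hXq : ‖x‖ * (1 - θ₁ ^ 2 / 2) ≤ ⟪x, q⟫ := by
    rw [← hX]; exact mul_le_mul_of_nonneg_left hY hx.le
  rw [e2]
  have hs : (‖x‖ - 1) ^ 2 ≤ 1 / 10000 := by nlinarith
  have hθ : ‖x‖ * θ₁ ^ 2 ≤ 101 / 100 * θ₁ ^ 2 := mul_le_mul_of_nonneg_right h2 (sq_nonneg θ₁)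
  nlinarith

/-- **Radial loss, one point, with the dial inequality**: under `101/100 · θ₁² + 1/10000 ≤ θ²` and `0 ≤ θ` the point is
`θ`-close to `q`. -/
theorem dist_le_of_normalize_close {x q : E3} {θ θ₁ : ℝ} (h1 : 1 ≤ ‖x‖) (h2 : ‖x‖ ≤ 101 / 100) (hq : ‖q‖ = 1)
    (hθ : 0 ≤ θ) (hle : 101 / 100 * θ₁ ^ 2 + 1 / 10000 ≤ θ ^ 2) (h : dist (‖x‖⁻¹ • x) q ≤ θ₁) : dist x q ≤ θ := by
  have h2' : dist x q ^ 2 ≤ θ ^ 2 := by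
    have := dist_sq_le_of_normalize_close h1 h2 hq h; linarith
  exact (pow_le_pow_iff_left₀ dist_nonneg hθ two_ne_zero).1 h2'

/-- **Radial loss, tuples.**  If the radial projection of a scale-free dozen is `θ₁`-`TupleClose` to a tuple of UNIT vectors
`p`, then the dozen itself is `θ`-`TupleClose` to `p` whenever `101/100 · θ₁² + 1/10000 ≤ θ²`, `0 ≤ θ` (same isometry, same
relabelling). -/
theorem tupleClose_of_normalize {t p : Fin 12 → E3} {b : Fin 12 → Fin 12 → Prop} {θ θ₁ : ℝ}
    (hD : IsScaleFreeDozen t b) (hp : ∀ k, ‖p k‖ = 1) (hθ : 0 ≤ θ) (hle : 101 / 100 * θ₁ ^ 2 + 1 / 10000 ≤ θ ^ 2)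
    (h : TupleClose θ₁ (fun k => ‖t k‖⁻¹ • t k) p) : TupleClose θ t p := by
  obtain ⟨A, σ, hA⟩ := h
  refine ⟨A, σ, fun k => ?_⟩
  have hq : ‖A (p (σ k))‖ = 1 := by rw [LinearIsometry.norm_map]; exact hp _
  exact dist_le_of_normalize_close (hD.one_le_norm k) (hD.norm_le k) hq hθ hle (hA k)

/-! ## §4 The translation -/

/-- **[C^sph] ⟹ [C].**  For a tuple of unit vectors `p`, `SphericalGraphedClose θ₁ p` implies `GraphedDozenClose θ p`
whenever `101/100 · θ₁² + 1/10000 ≤ θ²` and `0 ≤ θ`: part W's dictionary turns the scale-free dozen into a windowed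
spherical code with the SAME contact graph (so the same `σ` witnesses `TupleIso`), and the radial loss lemma lifts the conclusion. -/
theorem graphedDozenClose_of_spherical {θ θ₁ : ℝ} {p : Fin 12 → E3} (hp : ∀ k, ‖p k‖ = 1) (hθ : 0 ≤ θ)
    (hle : 101 / 100 * θ₁ ^ 2 + 1 / 10000 ≤ θ ^ 2) (h : SphericalGraphedClose θ₁ p) : GraphedDozenClose θ p := by
  intro t b hD σ hiso
  exact tupleClose_of_normalize hD hp hθ hle (h _ b hD.isWindowedCode_normalize σ hiso)

/-- The fcc tuple consists of unit vectors. -/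
theorem norm_fccTuple (k : Fin 12) : ‖fccTuple k‖ = 1 :=
  norm_eq_one_of_mem_fccKissingPattern (by
    rw [← image_fccTuple]; exact Finset.mem_image_of_mem _ (Finset.mem_univ k))

/-- The hcp tuple consists of unit vectors. -/
theorem norm_hcpTuple (k : Fin 12) : ‖hcpTuple k‖ = 1 :=
  norm_eq_one_of_mem_hcpKissingPattern (by
    rw [← image_hcpTuple]; exact Finset.mem_image_of_mem _ (Finset.mem_univ k))

/-- **[C]fcc at the dial value from its spherical form**: `SphericalGraphedClose (37/250) fccTuple → GraphedDozenClose (3/20) fccTuple`. -/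
theorem graphedDozenClose_fcc_of_spherical (h : SphericalGraphedClose (37 / 250) fccTuple) :
    GraphedDozenClose (3 / 20) fccTuple :=
  graphedDozenClose_of_spherical norm_fccTuple (by norm_num) (by norm_num) h

/-- **[C]hcp at the dial value from its spherical form**: `SphericalGraphedClose (37/250) hcpTuple → GraphedDozenClose (3/20) hcpTuple`. -/
theorem graphedDozenClose_hcp_of_spherical (h : SphericalGraphedClose (37 / 250) hcpTuple) :
    GraphedDozenClose (3 / 20) hcpTuple :=
  graphedDozenClose_of_spherical norm_hcpTuple (by norm_num) (by norm_num) h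

end Summit.AtomisticToContinuum.Crystallization.Theorems.ChargedEnergyGapChartDial
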